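import Summits.CriticalPhenomena.PercolationContinuityZ3.Theorems.PercNearOneGluingNoHeavyLowerTailFourPointExchangeEF

/-!
# Four-point exchange inequalities, types F1 and G (all `n`)

Support file for crux `stmt-CriticalPhenomena-4575` (master-family programme, row `Q44`, single-source packing; MONO-A
line), seat `prim-bnk-1` gen 33; memo `run/shared/lean/prim/prim-l12/FROM-prim-bnk-1-gen33-LAW-LEVEL-MONO-A.md` header (4) / §6.
Cells numbered as `FourPointAtoms.pat4`
(`0 a|b|c|y, 1 a|b|cy, 2 a|by|c, 3 a|bc|y, 4 ay|b|c, 5 ac|b|y, 6 ab|c|y, 7 a|bcy, 8 ay|bc, 9 ac|by, 10 acy|b, 11 ab|cy, 12 aby|c, 13 abc|y, 14 abcy`).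
* `typeF1_cell`: `cell 11 · cell 9 ≤ cell 6 · cell 14` (`μ(ab|cy)μ(ac|by) ≤ μ(ab|c|y)μ(abcy)`): the conditional Harris inequality
  `P(c↔y | a↔b, a↮{c,y}) ≤ P(c↔y | a↮{c,y})` (`CondHarris.condHarris_cluster_mono_off_mono`, cluster function `1{b ∈ C_a}`
  against the off-cluster event `{c↔y}`) and two Harris inequalities;
* `typeG_cell` : `cell 11 · cell 7 ≤ cell 1 · cell 14` (`μ(ab|cy)μ(a|bcy) ≤ μ(a|b|cy)μ(abcy)`): the same with source `c`,
  cluster function `1{y ∈ C_c}` and off-cluster event `{a↔b}`.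
All hold for all marked points.  No named facts, no sorries, no definitions.
-/

noncomputable section

namespace Summit.CriticalPhenomena.PercolationContinuityZ3.Theorems

namespace FourPointExchange

open MeasureTheory Set Literature.Probability.Percolation Literature.Probability.Percolation.BHK2006
open Literature.Probability.LatticeModels (prodBernoulli)
open DecisionTree (ind ind_of_mem ind_of_not_mem ind_nonneg)
open CondHarris FourPointAtoms
open Summit.CriticalPhenomena.PercolationContinuityZ3.Cruxes.AdditiveGluing.TieLine.ConnAtoms
open scoped Classical

variable {V : Type*} [Fintype V] (w : Sym2 V → unitInterval) (a b c y : V)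

/-! ## Types F1 and G: one conditional Harris step each -/

/-- **Type F1 exchange inequality** (all `n`): `μ(ab|cy)·μ(ac|by) ≤ μ(ab|c|y)·μ(abcy)` — the conditional Harris inequality
`P(c↔y | a↔b, a↮{c,y}) ≤ P(c↔y | a↮{c,y})` and two Harris inequalities. [this work] -/
theorem typeF1_cell : cell w a b c y 11 * cell w a b c y 9 ≤ cell w a b c y 6 * cell w a b c y 14 := by
  have real_cy : (prodBernoulli w).real (openConn c y) =
      cell w a b c y 1 + cell w a b c y 7 + cell w a b c y 10 + cell w a b c y 11 + cell w a b c y 14 := by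
    rw [measureReal_eq_cellSum w a b c y (show HasPattern (quad a b c y) (openConn c y) _ from oc a b c y 2 3 rfl rfl)]
    simp (config := {decide := true}) only [ite_true, ite_false]; ring
  have real_cy_acby : (prodBernoulli w).real (openConn c y ∩ (openConn a c ∩ openConn b y)) = cell w a b c y 14 := by
    rw [measureReal_eq_cellSum w a b c y (show HasPattern (quad a b c y) (openConn c y ∩ (openConn a c ∩ openConn b y)) _ from
      ((oc a b c y 2 3 rfl rfl).inter ((oc a b c y 0 2 rfl rfl).inter (oc a b c y 1 3 rfl rfl))))]
    simp (config := {decide := true}) only [ite_true, ite_false]; ring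
  have real_Da_cy : (prodBernoulli w).real ((openConn a c)ᶜ ∩ (openConn a y)ᶜ) =
      cell w a b c y 0 + cell w a b c y 1 + cell w a b c y 2 + cell w a b c y 3 + cell w a b c y 6 + cell w a b c y 7 +
        cell w a b c y 11 := by
    rw [measureReal_eq_cellSum w a b c y (show HasPattern (quad a b c y) ((openConn a c)ᶜ ∩ (openConn a y)ᶜ) _ from
      ((oc a b c y 0 2 rfl rfl).compl.inter (oc a b c y 0 3 rfl rfl).compl))]
    simp (config := {decide := true}) only [ite_true, ite_false]; ring
  have real_ab_cy_Da : (prodBernoulli w).real (openConn a b ∩ openConn c y ∩ ((openConn a c)ᶜ ∩ (openConn a y)ᶜ)) =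
      cell w a b c y 11 := by
    rw [measureReal_eq_cellSum w a b c y (show HasPattern (quad a b c y) (openConn a b ∩ openConn c y ∩ ((openConn a c)ᶜ ∩ (openConn a y)ᶜ)) _ from
      (((oc a b c y 0 1 rfl rfl).inter (oc a b c y 2 3 rfl rfl)).inter ((oc a b c y 0 2 rfl rfl).compl.inter (oc a b c y 0 3 rfl rfl).compl)))]
    simp (config := {decide := true}) only [ite_true, ite_false]; ring
  have real_ab_Da : (prodBernoulli w).real (openConn a b ∩ ((openConn a c)ᶜ ∩ (openConn a y)ᶜ)) = cell w a b c y 6 + cell w a b c y 11 := by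
    rw [measureReal_eq_cellSum w a b c y (show HasPattern (quad a b c y) (openConn a b ∩ ((openConn a c)ᶜ ∩ (openConn a y)ᶜ)) _ from
      ((oc a b c y 0 1 rfl rfl).inter ((oc a b c y 0 2 rfl rfl).compl.inter (oc a b c y 0 3 rfl rfl).compl)))]
    simp (config := {decide := true}) only [ite_true, ite_false]; ring
  have real_cy_Da : (prodBernoulli w).real (openConn c y ∩ ((openConn a c)ᶜ ∩ (openConn a y)ᶜ)) =
      cell w a b c y 1 + cell w a b c y 7 + cell w a b c y 11 := by
    rw [measureReal_eq_cellSum w a b c y (show HasPattern (quad a b c y) (openConn c y ∩ ((openConn a c)ᶜ ∩ (openConn a y)ᶜ)) _ from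
      ((oc a b c y 2 3 rfl rfl).inter ((oc a b c y 0 2 rfl rfl).compl.inter (oc a b c y 0 3 rfl rfl).compl)))]
    simp (config := {decide := true}) only [ite_true, ite_false]; ring
  have p1 := cell_nonneg w a b c y 1; have p6 := cell_nonneg w a b c y 6; have p7 := cell_nonneg w a b c y 7
  have p9 := cell_nonneg w a b c y 9; have p10 := cell_nonneg w a b c y 10; have p11 := cell_nonneg w a b c y 11
  have p14 := cell_nonneg w a b c y 14; have p0 := cell_nonneg w a b c y 0; have p2 := cell_nonneg w a b c y 2
  have p3 := cell_nonneg w a b c y 3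
  by_cases ha : a ∈ ({c, y} : Set V)
  · -- then `{a ↮ c,y} = ∅`, so `cell 11 = 0`
    have h := real_ab_cy_Da
    rw [← Dis_two_eq, Dis_eq_empty ha, Set.inter_empty, measureReal_empty] at h
    rw [← h, zero_mul]; exact mul_nonneg p6 p14
  have hc : c ∈ ({c, y} : Set V) := by simp
  -- conditional Harris given `{a ↮ c,y}`: cluster function `1{b ∈ C_a}` vs the off-cluster event `{c ↔ y}`
  have d := condHarris_cluster_mono_off_mono w a ({c, y} : Set V) ha (clusterFn_monotone a b) (ind_openConn_monotone c y)
    (ind_openConn_off hc)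
  simp only [← ind_openConn_eq_clusterFn] at d
  rw [← real_inter_Dis, ← real_inter_Dis, ← measureReal_eq_sum, ← real_inter_inter_Dis, Dis_two_eq,
    real_Da_cy, real_ab_cy_Da, real_ab_Da, real_cy_Da] at d
  -- Harris: μ({c↔y} ∩ D) ≤ μ({c↔y}) μ(D);  μ({c↔y}) μ({a↔c}∩{b↔y}) ≤ μ(abcy)
  have hIcy : Monotone (ind (openConn c y)) := ind_openConn_monotone c y
  have hND : Antitone (ind ((openConn a c)ᶜ ∩ (openConn a y)ᶜ)) := ind_compl_inter_antitone a c y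
  have hI2 : Monotone (ind (openConn a c ∩ openConn b y)) :=
    ind_monotone_of_upClosed fun ω ω' h hω => ⟨reach_mono h hω.1, reach_mono h hω.2⟩
  have e1 := harris_inc_dec w hIcy hND
  have e2 := harris_inc_inc w hIcy hI2
  rw [real_cy_Da, real_cy, real_Da_cy] at e1
  rw [real_cy, SwitchRelax.IncDict.d54, real_cy_acby] at e2
  set P := cell w a b c y 0 + cell w a b c y 1 + cell w a b c y 2 + cell w a b c y 3 + cell w a b c y 6 + cell w a b c y 7 +
    cell w a b c y 11 with hP
  set Q := cell w a b c y 1 + cell w a b c y 7 + cell w a b c y 10 + cell w a b c y 11 + cell w a b c y 14 with hQ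
  -- d : P · c11 ≤ (c6+c11)(c1+c7+c11);  e1 : c1+c7+c11 ≤ Q P;  e2 : Q (c9+c14) ≤ c14
  by_cases hc11 : cell w a b c y 11 = 0
  · rw [hc11, zero_mul]; exact mul_nonneg p6 p14
  have hPpos : 0 < P := by
    have : 0 < cell w a b c y 11 := lt_of_le_of_ne p11 (Ne.symm hc11)
    rw [hP]; linarith
  have key : P * (cell w a b c y 11 * (cell w a b c y 9 + cell w a b c y 14)) ≤ P * ((cell w a b c y 6 + cell w a b c y 11) * cell w a b c y 14) :=
    calc P * (cell w a b c y 11 * (cell w a b c y 9 + cell w a b c y 14))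
        = (P * cell w a b c y 11) * (cell w a b c y 9 + cell w a b c y 14) := by ring
      _ ≤ ((cell w a b c y 6 + cell w a b c y 11) * (cell w a b c y 1 + cell w a b c y 7 + cell w a b c y 11)) *
            (cell w a b c y 9 + cell w a b c y 14) := mul_le_mul_of_nonneg_right d (by positivity)
      _ ≤ ((cell w a b c y 6 + cell w a b c y 11) * (Q * P)) * (cell w a b c y 9 + cell w a b c y 14) :=
          mul_le_mul_of_nonneg_right (mul_le_mul_of_nonneg_left e1 (by positivity)) (by positivity)
      _ = (cell w a b c y 6 + cell w a b c y 11) * P * (Q * (cell w a b c y 9 + cell w a b c y 14)) := by ring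
      _ ≤ (cell w a b c y 6 + cell w a b c y 11) * P * cell w a b c y 14 := mul_le_mul_of_nonneg_left e2 (by positivity)
      _ = P * ((cell w a b c y 6 + cell w a b c y 11) * cell w a b c y 14) := by ring
  nlinarith [le_of_mul_le_mul_left key hPpos]

/-- **Type G exchange inequality** (all `n`): `μ(ab|cy)·μ(a|bcy) ≤ μ(a|b|cy)·μ(abcy)` — the conditional Harris inequality
`P(a↔b | c↔y, c↮{a,b}) ≤ P(a↔b | c↮{a,b})` and two Harris inequalities. [this work] -/
theorem typeG_cell : cell w a b c y 11 * cell w a b c y 7 ≤ cell w a b c y 1 * cell w a b c y 14 := by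
  have real_Dc_ab : (prodBernoulli w).real ((openConn c a)ᶜ ∩ (openConn c b)ᶜ) =
      cell w a b c y 0 + cell w a b c y 1 + cell w a b c y 2 + cell w a b c y 4 + cell w a b c y 6 + cell w a b c y 11 +
        cell w a b c y 12 := by
    rw [measureReal_eq_cellSum w a b c y (show HasPattern (quad a b c y) ((openConn c a)ᶜ ∩ (openConn c b)ᶜ) _ from
      ((oc a b c y 2 0 rfl rfl).compl.inter (oc a b c y 2 1 rfl rfl).compl))]
    simp (config := {decide := true}) only [ite_true, ite_false]; ring
  have real_cy_ab_Dc : (prodBernoulli w).real (openConn c y ∩ openConn a b ∩ ((openConn c a)ᶜ ∩ (openConn c b)ᶜ)) =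
      cell w a b c y 11 := by
    rw [measureReal_eq_cellSum w a b c y (show HasPattern (quad a b c y) (openConn c y ∩ openConn a b ∩ ((openConn c a)ᶜ ∩ (openConn c b)ᶜ)) _ from
      (((oc a b c y 2 3 rfl rfl).inter (oc a b c y 0 1 rfl rfl)).inter ((oc a b c y 2 0 rfl rfl).compl.inter (oc a b c y 2 1 rfl rfl).compl)))]
    simp (config := {decide := true}) only [ite_true, ite_false]; ring
  have real_cy_Dc : (prodBernoulli w).real (openConn c y ∩ ((openConn c a)ᶜ ∩ (openConn c b)ᶜ)) = cell w a b c y 1 + cell w a b c y 11 := by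
    rw [measureReal_eq_cellSum w a b c y (show HasPattern (quad a b c y) (openConn c y ∩ ((openConn c a)ᶜ ∩ (openConn c b)ᶜ)) _ from
      ((oc a b c y 2 3 rfl rfl).inter ((oc a b c y 2 0 rfl rfl).compl.inter (oc a b c y 2 1 rfl rfl).compl)))]
    simp (config := {decide := true}) only [ite_true, ite_false]; ring
  have real_ab_Dc : (prodBernoulli w).real (openConn a b ∩ ((openConn c a)ᶜ ∩ (openConn c b)ᶜ)) =
      cell w a b c y 6 + cell w a b c y 11 + cell w a b c y 12 := by
    rw [measureReal_eq_cellSum w a b c y (show HasPattern (quad a b c y) (openConn a b ∩ ((openConn c a)ᶜ ∩ (openConn c b)ᶜ)) _ from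
      ((oc a b c y 0 1 rfl rfl).inter ((oc a b c y 2 0 rfl rfl).compl.inter (oc a b c y 2 1 rfl rfl).compl)))]
    simp (config := {decide := true}) only [ite_true, ite_false]; ring
  have real_bcy : (prodBernoulli w).real (openConn b c ∩ openConn b y) = cell w a b c y 7 + cell w a b c y 14 := by
    rw [measureReal_eq_cellSum w a b c y (show HasPattern (quad a b c y) (openConn b c ∩ openConn b y) _ from
      ((oc a b c y 1 2 rfl rfl).inter (oc a b c y 1 3 rfl rfl)))]
    simp (config := {decide := true}) only [ite_true, ite_false]; ring
  have real_ab_bcy : (prodBernoulli w).real (openConn a b ∩ (openConn b c ∩ openConn b y)) = cell w a b c y 14 := by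
    rw [measureReal_eq_cellSum w a b c y (show HasPattern (quad a b c y) (openConn a b ∩ (openConn b c ∩ openConn b y)) _ from
      ((oc a b c y 0 1 rfl rfl).inter ((oc a b c y 1 2 rfl rfl).inter (oc a b c y 1 3 rfl rfl))))]
    simp (config := {decide := true}) only [ite_true, ite_false]; ring
  have p0 := cell_nonneg w a b c y 0; have p1 := cell_nonneg w a b c y 1; have p2 := cell_nonneg w a b c y 2
  have p4 := cell_nonneg w a b c y 4; have p6 := cell_nonneg w a b c y 6; have p7 := cell_nonneg w a b c y 7
  have p11 := cell_nonneg w a b c y 11; have p12 := cell_nonneg w a b c y 12; have p13 := cell_nonneg w a b c y 13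
  have p14 := cell_nonneg w a b c y 14
  by_cases hc : c ∈ ({a, b} : Set V)
  · have h := real_cy_ab_Dc
    rw [← Dis_two_eq, Dis_eq_empty hc, Set.inter_empty, measureReal_empty] at h
    rw [← h, zero_mul]; exact mul_nonneg p1 p14
  have ha : a ∈ ({a, b} : Set V) := by simp
  have d := condHarris_cluster_mono_off_mono w c ({a, b} : Set V) hc (clusterFn_monotone c y) (ind_openConn_monotone a b)
    (ind_openConn_off ha)
  simp only [← ind_openConn_eq_clusterFn] at d
  rw [← real_inter_Dis, ← real_inter_Dis, ← measureReal_eq_sum, ← real_inter_inter_Dis, Dis_two_eq,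
    real_Dc_ab, real_cy_ab_Dc, real_cy_Dc, real_ab_Dc] at d
  have hIab : Monotone (ind (openConn a b)) := ind_openConn_monotone a b
  have hND : Antitone (ind ((openConn c a)ᶜ ∩ (openConn c b)ᶜ)) := ind_compl_inter_antitone c a b
  have hI2 : Monotone (ind (openConn b c ∩ openConn b y)) :=
    ind_monotone_of_upClosed fun ω ω' h hω => ⟨reach_mono h hω.1, reach_mono h hω.2⟩
  have e1 := harris_inc_dec w hIab hND
  have e2 := harris_inc_inc w hIab hI2
  rw [real_ab_Dc, SwitchRelax.Finc24.rE2, real_Dc_ab] at e1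
  rw [SwitchRelax.Finc24.rE2, real_bcy, real_ab_bcy] at e2
  set P := cell w a b c y 0 + cell w a b c y 1 + cell w a b c y 2 + cell w a b c y 4 + cell w a b c y 6 + cell w a b c y 11 +
    cell w a b c y 12 with hP
  set Q := cell w a b c y 6 + cell w a b c y 11 + cell w a b c y 12 + cell w a b c y 13 + cell w a b c y 14 with hQ
  -- d : P · c11 ≤ (c1+c11)(c6+c11+c12);  e1 : c6+c11+c12 ≤ Q P;  e2 : Q (c7+c14) ≤ c14
  by_cases hc11 : cell w a b c y 11 = 0
  · rw [hc11, zero_mul]; exact mul_nonneg p1 p14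
  have hPpos : 0 < P := by
    have : 0 < cell w a b c y 11 := lt_of_le_of_ne p11 (Ne.symm hc11)
    rw [hP]; linarith
  have key : P * (cell w a b c y 11 * (cell w a b c y 7 + cell w a b c y 14)) ≤ P * ((cell w a b c y 1 + cell w a b c y 11) * cell w a b c y 14) :=
    calc P * (cell w a b c y 11 * (cell w a b c y 7 + cell w a b c y 14))
        = (P * cell w a b c y 11) * (cell w a b c y 7 + cell w a b c y 14) := by ring
      _ ≤ ((cell w a b c y 1 + cell w a b c y 11) * (cell w a b c y 6 + cell w a b c y 11 + cell w a b c y 12)) *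
            (cell w a b c y 7 + cell w a b c y 14) := mul_le_mul_of_nonneg_right d (by positivity)
      _ ≤ ((cell w a b c y 1 + cell w a b c y 11) * (Q * P)) * (cell w a b c y 7 + cell w a b c y 14) :=
          mul_le_mul_of_nonneg_right (mul_le_mul_of_nonneg_left e1 (by positivity)) (by positivity)
      _ = (cell w a b c y 1 + cell w a b c y 11) * P * (Q * (cell w a b c y 7 + cell w a b c y 14)) := by ring
      _ ≤ (cell w a b c y 1 + cell w a b c y 11) * P * cell w a b c y 14 := mul_le_mul_of_nonneg_left e2 (by positivity)
      _ = P * ((cell w a b c y 1 + cell w a b c y 11) * cell w a b c y 14) := by ring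
  nlinarith [le_of_mul_le_mul_left key hPpos]

end FourPointExchange

end Summit.CriticalPhenomena.PercolationContinuityZ3.Theorems
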